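import Summits.BirchSwinnertonDyer.BirchSwinnertonDyer.Theorems.SmallImageMuTransferMuTransferX9StepOneSahX9
import HarnessLib

/-!
# Step 1 of the `μ`-transfer core (`stub_coreX9`, crux 19276): Sah on the joint kernel

HOME/koly/MU-TRANSFER-PROOF.md (F8) for the PAIR `(h, h^*)`: the joint value module
`M = im(h, h^*)` (tree `contOneCocycles.jointValueSubgroup`) lives on a subgroup acting trivially on
BOTH `𝒯_e(E)` and `𝒯_e^*(E)`; the latter is the `κ⁻¹`-twist (`κ.invTwist`), so the natural choice
is `N = N_e(κ) ⊓ N_e(κ')` for two `ℤ_p`-extensions `κ, κ'`. The central homothety of class X9 is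
central modulo each kernel, hence modulo the intersection (`mk_mem_center_quotient_inf`), so Sah
gives: every cocycle of `E[p]` with non-zero class is non-zero on `N_J(κ) ⊓ N_{J'}(κ')`
(`exists_mem_inf_ker_apply_ne_zero`).

PARTITION (D-0054): X9 (A4) — helper toward `stub_coreX9`; closes none.
-/

set_option linter.dupNamespace false

noncomputable section

open Literature.NumberTheory.EllipticCurves Literature.NumberTheory.GaloisRepresentations Field
  Function

namespace Summit.BirchSwinnertonDyer.BirchSwinnertonDyer.Rank1Residual.LevelE

section group

variable {G : Type*} [Group G]

/-- `z` is central modulo a normal subgroup `N` iff all commutators `(σz)⁻¹(zσ)` lie in `N`.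
[cite: Sah1968, Prop. 2.7 (b)] -/
theorem mk_mem_center_quotient_iff (N : Subgroup G) [N.Normal] (z : G) :
    (z : G ⧸ N) ∈ Subgroup.center (G ⧸ N) ↔ ∀ σ : G, (σ * z)⁻¹ * (z * σ) ∈ N := by
  rw [Subgroup.mem_center_iff]
  constructor
  · intro h σ
    rw [← QuotientGroup.eq, QuotientGroup.mk_mul, QuotientGroup.mk_mul]
    exact h σ
  · intro h g
    induction g using QuotientGroup.induction_on with
    | H σ =>
      rw [← QuotientGroup.mk_mul, ← QuotientGroup.mk_mul, QuotientGroup.eq]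
      exact h σ

/-- Central modulo `N` and modulo `N'` implies central modulo `N ⊓ N'`.
[cite: Sah1968, Prop. 2.7 (b)] -/
theorem mk_mem_center_quotient_inf (N N' : Subgroup G) [N.Normal] [N'.Normal] (z : G)
    (h : (z : G ⧸ N) ∈ Subgroup.center (G ⧸ N)) (h' : (z : G ⧸ N') ∈ Subgroup.center (G ⧸ N')) :
    (z : G ⧸ (N ⊓ N')) ∈ Subgroup.center (G ⧸ (N ⊓ N')) := by
  rw [mk_mem_center_quotient_iff] at h h' ⊢
  exact fun σ => ⟨h σ, h' σ⟩

end group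

variable (W : WeierstrassCurve ℚ) [W.IsElliptic] (p : ℕ) [Fact p.Prime] (κ κ' : ZpExtension ℚ p)

/-- **(F8) for the pair `(h, h^*)` on class X9**: for `p ≥ 5`, `E[p]` irreducible and `ρ̄` not
surjective, every continuous 1-cocycle of `E[p]` with non-zero class is non-zero on
`N_J(κ) ⊓ N_{J'}(κ')`, the joint kernel of the actions on `𝒯_J(E, κ)` and `𝒯_{J'}(E, κ')` (take
`κ' = κ.invTwist` for the dual deformation). [cite: Sah1968, Prop. 2.7 (b)] [cite: Serre1972, §2.4 Prop. 15] -/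
theorem exists_mem_inf_ker_apply_ne_zero (hp5 : 5 ≤ p) (hirr : W.HasIrreducibleModPGaloisRep p)
    (hns : ¬ W.HasSurjectiveModNGaloisRep p) (J J' : ℕ)
    (ψ : contOneCocycles (W.torsionGaloisModule (p : ℤ)).toTopRep)
    (hψ : oneCocycleClass (W.torsionGaloisModule (p : ℤ)).toTopRep ψ ≠ 0) :
    ∃ τ ∈ (κ.twistModPRepresentation (W.torsionGaloisModule (p : ℤ))
          (fun P : WeierstrassCurve.geomTorsion W (p : ℤ) => AddSubgroup.torsionBy.nsmul P) J).ker ⊓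
        (κ'.twistModPRepresentation (W.torsionGaloisModule (p : ℤ))
          (fun P : WeierstrassCurve.geomTorsion W (p : ℤ) => AddSubgroup.torsionBy.nsmul P) J').ker,
      ψ.1 τ ≠ 0 := by
  have hp : p.Prime := Fact.out
  haveI : Finite (WeierstrassCurve.geomTorsion W (p : ℤ)) :=
    WeierstrassCurve.finite_torsionPoints_holds W (AlgebraicClosure ℚ) (by exact_mod_cast hp.ne_zero)
  obtain ⟨z, a, hza, hz0⟩ := exists_homothety_noFixedVector W p hp5 hirr hns
  exact galoisCohomology.exists_mem_apply_ne_zero_of_isOpen (W.torsionGaloisModule (p : ℤ)) _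
    ((κ.isOpen_ker_twistModPRepresentation (W.torsionGaloisModule (p : ℤ)) _ J).inter
      (κ'.isOpen_ker_twistModPRepresentation (W.torsionGaloisModule (p : ℤ)) _ J'))
    (mk_mem_center_quotient_inf _ _ z
      (κ.mk_mem_center_quotient_ker_of_smul (W.torsionGaloisModule (p : ℤ)) _ J hza)
      (κ'.mk_mem_center_quotient_ker_of_smul (W.torsionGaloisModule (p : ℤ)) _ J' hza)) hz0 ψ hψ

end Summit.BirchSwinnertonDyer.BirchSwinnertonDyer.Rank1Residual.LevelE

end
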